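import Mathlib.Data.Nat.Bitwise
import Mathlib.Data.Finset.Card
import Mathlib.Data.Finset.SymmDiff
import Mathlib.Data.Fintype.Fin
import Mathlib.Algebra.BigOperators.Group.Finset.Basic
import Mathlib.Algebra.Group.Nat.Even
import Mathlib.Tactic

/-!
# The extended binary Golay code (kernel-checked facts for the Leech kissing configuration)

Framing: lottery ticket; floor = certified bounds/negative ranges. Venture `PackingBounds` (cell
`pub-packcert`, seat `pub-packcert-energy`), attained side of `κ(24) = 196560`.

The extended Golay code `𝒢₂₄ ⊂ 𝔽₂²⁴` is entered by a systematic generator matrix `[I₁₂ | A]`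
(`genRow j`, `24`-bit masks; `A` = bordered circulant of the quadratic residues mod `11`). A codeword is
the `XOR` of the generator rows selected by the bits of a message `u < 4096` (`cw u`); its support is a
`Finset (Fin 24)` (`supp`), its weight `wt`. The kernel checks, by `decide` over the `4096` messages:
every weight is `≡ 0 (mod 4)` and is `0` or `≥ 8` (`cw_facts`), the encoding is systematic
(`cw_sys`, hence injective) and there are exactly `759` codewords of weight `8` (octads, `octList_length`).
Everything else is proved: linearity (`cw_xor`), the octads `osupp o` (`o : Fin 759`) have `8` elements,
two distinct octads meet in at most `4` points (`card_osupp_inter_le`), and every codeword meets every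
octad in an even number of points (`even_card_supp_inter_osupp`, self-orthogonality) — exactly the facts
used in `Configurations/LeechVectors.lean` to bound the inner products of the `196560` Leech minimal vectors.

## References
* J. H. Conway, N. J. A. Sloane, *Sphere Packings, Lattices and Groups*, Ch. 3 §2.8 (Golay code),
  Ch. 4 §11 (the Leech lattice), Ch. 10 §1. [`ConwaySloane1999`]
-/

namespace Summit.Ventures.PackingBounds.Config.Golay

open Finset
open scoped symmDiff

/-! ### Definitions -/

/-- Generator rows of the extended Golay code as `24`-bit masks, systematic form `[I₁₂ | A]`
(bit `j` of row `j` is the only low bit set). [cite: ConwaySloane1999, Ch. 3 §2.8] -/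
def genRow (j : ℕ) : ℕ :=
  match j with
  | 0 => 16769025 | 1 => 4681730 | 2 => 9359364 | 3 => 1945608 | 4 => 3887120 | 5 => 7770144
  | 6 => 15536192 | 7 => 14299264 | 8 => 11825408 | 9 => 6877696 | 10 => 13751296 | 11 => 10729472
  | _ => 0

/-- Codeword (as a `24`-bit mask) of the message `u`, using the first `j` generator rows. -/
def cwAux : ℕ → ℕ → ℕ
  | 0, _ => 0
  | j + 1, u => (if u.testBit j then genRow j else 0) ^^^ cwAux j u

/-- The codeword of the message `u` (`u < 4096`): `XOR` of the generator rows selected by the bits of `u`. -/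
def cw (u : ℕ) : ℕ := cwAux 12 u

/-- Support of a `24`-bit mask, as a finite set of coordinates. -/
def supp (m : ℕ) : Finset (Fin 24) := univ.filter fun k => m.testBit k.val

/-- Hamming weight of a `24`-bit mask. -/
def wt (m : ℕ) : ℕ := (supp m).card

/-- The messages whose codewords have weight `8` (the `759` octads). -/
def octList : List ℕ := (List.range 4096).filter fun u => wt (cw u) = 8

/-! ### Kernel-checked facts -/

set_option maxRecDepth 100000 in
/-- Every codeword has weight `≡ 0 (mod 4)`, and weight `0` only for the zero message, else `≥ 8`.
[cite: ConwaySloane1999, Ch. 3 §2.8] -/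
theorem cw_facts : ∀ u < 4096, wt (cw u) % 4 = 0 ∧ (u = 0 ∨ 8 ≤ wt (cw u)) := by
  decide +kernel

set_option maxRecDepth 100000 in
/-- The encoding is systematic (the low `12` bits of `cw u` are `u`) and codewords are `24`-bit masks. -/
theorem cw_sys : ∀ u < 4096, cw u % 4096 = u ∧ cw u < 2 ^ 24 := by
  decide +kernel

set_option maxRecDepth 100000 in
/-- There are exactly `759` octads. [cite: ConwaySloane1999, Ch. 3 §2.8] -/
theorem octList_length : octList.length = 759 := by
  decide +kernel

/-! ### Linearity and its consequences -/

/-- `cwAux` is additive (over `𝔽₂`). -/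
theorem cwAux_xor (j u v : ℕ) : cwAux j (u ^^^ v) = cwAux j u ^^^ cwAux j v := by
  induction j with
  | zero => simp [cwAux]
  | succ j ih =>
    simp only [cwAux, Nat.testBit_xor, ih]
    cases u.testBit j <;> cases v.testBit j <;> simp [Nat.xor_assoc, Nat.xor_left_comm, Nat.xor_comm]

/-- The encoding is additive: `cw (u ⊕ v) = cw u ⊕ cw v`. -/
theorem cw_xor (u v : ℕ) : cw (u ^^^ v) = cw u ^^^ cw v := cwAux_xor 12 u v

/-- `cw 0 = 0`. -/
theorem cw_zero : cw 0 = 0 := by decide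

/-- The encoding is injective on messages `< 4096`. -/
theorem cw_injective {u v : ℕ} (hu : u < 4096) (hv : v < 4096) (h : cw u = cw v) : u = v := by
  rw [← (cw_sys u hu).1, ← (cw_sys v hv).1, h]

/-- Two distinct messages `< 4096` give a nonzero message `u ⊕ v < 4096`. -/
theorem xor_lt_and_ne {u v : ℕ} (hu : u < 4096) (hv : v < 4096) (h : u ≠ v) :
    u ^^^ v < 4096 ∧ u ^^^ v ≠ 0 := by
  refine ⟨?_, fun h0 => h ?_⟩
  swap
  · have e : u = (u ^^^ v) ^^^ v := by rw [Nat.xor_assoc, Nat.xor_self, Nat.xor_zero]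
    rw [h0, Nat.zero_xor] at e
    exact e
  have := Nat.xor_lt_two_pow (n := 12) (by simpa using hu) (by simpa using hv)
  simpa using this

/-- The codeword of `u ⊕ v` (`u ≠ v` messages) has weight `≥ 8`. -/
theorem wt_cw_xor_ge {u v : ℕ} (hu : u < 4096) (hv : v < 4096) (h : u ≠ v) :
    8 ≤ wt (cw (u ^^^ v)) := by
  obtain ⟨hlt, hne⟩ := xor_lt_and_ne hu hv h
  exact ((cw_facts _ hlt).2).resolve_left hne

/-- Membership in the support. -/
@[simp] theorem mem_supp {m : ℕ} {k : Fin 24} : k ∈ supp m ↔ m.testBit k.val = true := by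
  simp [supp]

/-- The support of a `XOR` is the symmetric difference of the supports. -/
theorem supp_xor (m n : ℕ) : supp (m ^^^ n) = supp m ∆ supp n := by
  ext k
  simp only [mem_supp, Nat.testBit_xor, Finset.mem_symmDiff]
  cases m.testBit k.val <;> cases n.testBit k.val <;> simp

/-- `|s ∆ t| + 2 |s ∩ t| = |s| + |t|` for sets of coordinates (kept private: a generic copy is
`Literature.Probability.LatticeModels.Current.card_symmDiff_add`). -/
private theorem card_symmDiff_add_two_mul (s t : Finset (Fin 24)) :
    (s ∆ t).card + 2 * (s ∩ t).card = s.card + t.card := by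
  rw [symmDiff_eq_sup_sdiff_inf, sup_eq_union, inf_eq_inter,
    card_sdiff_of_subset (inter_subset_union), ← card_union_add_card_inter]
  have : (s ∩ t).card ≤ (s ∪ t).card := card_le_card inter_subset_union
  omega

/-- Masks below `2 ^ 24` with the same support are equal. -/
theorem eq_of_supp_eq {m n : ℕ} (hm : m < 2 ^ 24) (hn : n < 2 ^ 24) (h : supp m = supp n) : m = n := by
  apply Nat.eq_of_testBit_eq
  intro i
  by_cases hi : i < 24
  · have := Finset.ext_iff.mp h ⟨i, hi⟩
    simp only [mem_supp] at this
    cases hmi : m.testBit i <;> cases hni : n.testBit i <;> simp_all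
  · have h24 : 2 ^ 24 ≤ 2 ^ i := Nat.pow_le_pow_right (by norm_num) (by omega)
    rw [Nat.testBit_eq_false_of_lt (lt_of_lt_of_le hm h24),
      Nat.testBit_eq_false_of_lt (lt_of_lt_of_le hn h24)]

/-- **Self-orthogonality**: two codewords meet in an even number of coordinates (all weights are
`≡ 0 (mod 4)`). [cite: ConwaySloane1999, Ch. 3 §2.8] -/
theorem even_card_supp_inter {u v : ℕ} (hu : u < 4096) (hv : v < 4096) :
    Even ((supp (cw u) ∩ supp (cw v)).card) := by
  have h1 := (cw_facts u hu).1
  have h2 := (cw_facts v hv).1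
  have hlt : u ^^^ v < 4096 := by
    have := Nat.xor_lt_two_pow (n := 12) (by simpa using hu) (by simpa using hv); simpa using this
  have h3 := (cw_facts _ hlt).1
  have hid := card_symmDiff_add_two_mul (supp (cw u)) (supp (cw v))
  rw [← supp_xor, ← cw_xor] at hid
  unfold wt at h1 h2 h3
  refine ⟨(supp (cw u) ∩ supp (cw v)).card / 2, ?_⟩
  omega

/-! ### Octads -/

/-- The message of the `o`-th octad. -/
def octU (o : Fin 759) : ℕ := octList.getD o.val 0

/-- The `o`-th octad, a set of `8` coordinates. [cite: ConwaySloane1999, Ch. 3 §2.8] -/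
def osupp (o : Fin 759) : Finset (Fin 24) := supp (cw (octU o))

/-- Octad messages belong to the octad list. -/
theorem octU_mem (o : Fin 759) : octU o ∈ octList := by
  have ho : o.val < octList.length := by rw [octList_length]; exact o.isLt
  rw [octU, List.getD_eq_getElem _ _ ho]
  exact List.getElem_mem ho

/-- Octad messages are `< 4096`. -/
theorem octU_lt (o : Fin 759) : octU o < 4096 := by
  have h := octU_mem o
  simp only [octList, List.mem_filter, List.mem_range] at h
  exact h.1

/-- Octads have `8` elements. -/
theorem card_osupp (o : Fin 759) : (osupp o).card = 8 := by
  have h := octU_mem o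
  simp only [octList, List.mem_filter, List.mem_range, decide_eq_true_eq] at h
  exact h.2

/-- Distinct indices give distinct octad messages. -/
theorem octU_injective : Function.Injective octU := by
  intro o o' h
  have hnd : octList.Nodup := (List.nodup_range).filter _
  have ho : o.val < octList.length := by rw [octList_length]; exact o.isLt
  have ho' : o'.val < octList.length := by rw [octList_length]; exact o'.isLt
  rw [octU, octU, List.getD_eq_getElem _ _ ho, List.getD_eq_getElem _ _ ho'] at h
  exact Fin.ext ((hnd.getElem_inj_iff).mp h)

/-- Distinct octads are distinct sets. -/
theorem osupp_injective : Function.Injective osupp := by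
  intro o o' h
  have h' : cw (octU o) = cw (octU o') :=
    eq_of_supp_eq (cw_sys _ (octU_lt o)).2 (cw_sys _ (octU_lt o')).2 h
  exact octU_injective (cw_injective (octU_lt o) (octU_lt o') h')

/-- **Two distinct octads meet in at most `4` points.** [cite: ConwaySloane1999, Ch. 10 §1] -/
theorem card_osupp_inter_le {o o' : Fin 759} (h : o ≠ o') : (osupp o ∩ osupp o').card ≤ 4 := by
  have hne : octU o ≠ octU o' := fun e => h (octU_injective e)
  have h8 := wt_cw_xor_ge (octU_lt o) (octU_lt o') hne
  have hid := card_symmDiff_add_two_mul (osupp o) (osupp o')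
  rw [card_osupp, card_osupp] at hid
  unfold wt at h8
  rw [cw_xor, supp_xor] at h8
  change 8 ≤ (osupp o ∆ osupp o').card at h8
  omega

/-- **Every codeword meets every octad in an even number of points.** [cite: ConwaySloane1999, Ch. 3 §2.8] -/
theorem even_card_supp_inter_osupp {u : ℕ} (hu : u < 4096) (o : Fin 759) :
    Even ((supp (cw u) ∩ osupp o).card) :=
  even_card_supp_inter hu (octU_lt o)

/-! ### Weight enumerator and minimum distance -/

/-- The list of the `4096` codeword weights. -/
def weights : List ℕ := (List.range 4096).map fun u => wt (cw u)

set_option maxRecDepth 100000 in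
/-- **Weight enumerator of the extended Golay code**: `1 + 759 y⁸ + 2576 y¹² + 759 y¹⁶ + y²⁴`
(kernel-evaluated counts of the codeword weights). [cite: ConwaySloane1999, Ch. 3 §2.8] -/
theorem weight_distribution :
    weights.count 0 = 1 ∧ weights.count 8 = 759 ∧ weights.count 12 = 2576 ∧ weights.count 16 = 759 ∧
      weights.count 24 = 1 := by
  decide +kernel

/-- **Minimum distance `8`**: two distinct codewords differ in at least `8` coordinates.
[cite: ConwaySloane1999, Ch. 3 §2.8] -/
theorem eight_le_card_symmDiff_supp {u v : ℕ} (hu : u < 4096) (hv : v < 4096) (h : u ≠ v) :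
    8 ≤ (supp (cw u) ∆ supp (cw v)).card := by
  rw [← supp_xor, ← cw_xor]
  exact wt_cw_xor_ge hu hv h

/-- The all-ones word is a codeword (message `4095`), so the code — and the Leech minimal vectors built from
it — is closed under complementation / negation. [cite: ConwaySloane1999, Ch. 3 §2.8] -/
theorem cw_4095 : cw 4095 = 2 ^ 24 - 1 := by
  decide

end Summit.Ventures.PackingBounds.Config.Golay
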